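import Summits.ABC.IUTFork.Joshi.ATS4GaussianTwistPoints
import Literature.NumberTheory.DiophantineGeometry.GenEllAnnulus
import Literature.NumberTheory.DiophantineGeometry.GenEllNorthcott
import HarnessLib

/-!
# The Gaussian twist points `P_{a,b} = (ℚ(ζ₄), λ_{a,b})`: minimal of degree `2`, inside the annulus compactly bounded subset

Record file (D-0012) of the abc-iut cell, block E (rung LADDER-ABC:A2.E; seat abc-iut-E-t28, slot T-28 = [J-IV] §5.4–5.7,
authors-first companion chain deciding the literal @[claim] `ATS4.Thm571` of the LANDED row J4:Thm5.7.1). TAKES NO SIDE on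
[IUTchIII] Cor. 3.12, on the claims of K. Joshi, or on S. Mochizuki's reports on them; CLASSICAL arithmetic of `ℚ(√−1)`,
kernel-checked; typed ≠ proved; NO abc claim. No `Cor312*`/`Thm311*` import (E-PLAN R14).

WHAT IS HERE (proof-only). For `p = a² + b²` prime `≠ 2` and `P_{a,b} = gaussPoint a b` (`ATS4GaussianTwistPoints`): `λ ∈ U`
(`gaussPoint_inU`), `ℚ(λ) = ℚ(ζ₄)` (`zeta4_mem_adjoin_lam`: `ζ₄ = (pλ + 2ab)/(a² − b²)`; `gaussPoint_isMinimal`), so `P_{a,b} ∈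
U(ℚ̄)^{≤2}` (`gaussPoint_mem_UPle`); and **`gaussPoint_mem_annulus`**: `P_{a,b}` lies in the tree's `CBData.annulus {2} (1/2)`
([GenEll] Ex. 1.3 (ii); support `{∞, 2}`), because every conjugate is `1/2`-far from the cusps: in `ℚ̄₂` (`padic_farFromCusps`:
`‖σλ‖ = 1`, `‖σλ − 1‖ = ‖σζ₄ − 1‖ = 2^{−1/2}`, using `σλ − 1 = σ(α)(a+b)(σζ₄ − 1)/p`, `‖σα‖ = 1`, `p` and `a + b` odd, the
ultrametric inequality) and in `ℂ` (`complex_farFromCusps`: `|σλ| = 1`, `|σλ − 1|² = 2(a+b)²/p > 1/4`, via `σζ₄ = ±I`).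
Theorems only. [cite: MochizukiGenEll2010, Ex 1.3 (ii) p.5]
-/

noncomputable section

open scoped Classical

open NumberField IsDedekindDomain IsCyclotomicExtension Polynomial
open Literature.IUT.LogVolume Literature.IUT.LogVolume.Cor22
open Literature.NumberTheory.DiophantineGeometry.GenEll

namespace Summit.ABC.IUTFork.Joshi.ATS4

/-! ## 4. The point `P_{a,b} = (ℚ(ζ₄), λ_{a,b})` of `U(ℚ(ζ₄))`: degree `2`, minimal, in the annulus subset -/

section Point

variable (a b : ℕ)




variable {a b}


/-- `P_{a,b} ∈ U`: `λ ≠ 0, 1`. [folklore] -/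
theorem gaussPoint_inU (hp : (a ^ 2 + b ^ 2).Prime) : (gaussPoint a b).InU :=
  ⟨lam_ne_zero hp.ne_zero, lam_ne_one hp.ne_zero (by have := (pos_of_prime hp).1; omega)⟩

/-- `ζ₄ ∈ ℚ(λ)`: `ζ₄ = (p·λ + 2ab)/(a² − b²)`. [folklore] -/
theorem zeta4_mem_adjoin_lam (hp : (a ^ 2 + b ^ 2).Prime) (hp2 : a ^ 2 + b ^ 2 ≠ 2) :
    zeta4 ∈ IntermediateField.adjoin ℚ ({lam a b} : Set K4) := by
  set L := IntermediateField.adjoin ℚ ({lam a b} : Set K4) with hL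
  have hlam : lam a b ∈ L := IntermediateField.subset_adjoin ℚ _ (Set.mem_singleton _)
  have hab : ((a : K4) ^ 2 - (b : K4) ^ 2) ≠ 0 := by
    have hne := ne_of_prime hp hp2
    intro h
    have h' : ((a ^ 2 : ℕ) : ℚ) = ((b ^ 2 : ℕ) : ℚ) := by
      have : ((a : K4) ^ 2) = (b : K4) ^ 2 := sub_eq_zero.1 h
      have h2 : (((a ^ 2 : ℕ) : ℚ) : K4) = (((b ^ 2 : ℕ) : ℚ) : K4) := by push_cast; exact this
      exact_mod_cast h2
    have : a ^ 2 = b ^ 2 := by exact_mod_cast h'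
    exact hne (Nat.pow_left_injective two_ne_zero this)
  have hp0 : ((a ^ 2 + b ^ 2 : ℕ) : K4) ≠ 0 := by exact_mod_cast hp.ne_zero
  have key : zeta4 = (((a ^ 2 + b ^ 2 : ℕ) : K4) * lam a b + 2 * a * b) / ((a : K4) ^ 2 - (b : K4) ^ 2) := by
    rw [eq_div_iff hab, lam, mul_div_cancel₀ _ hp0, alphaK]
    linear_combination (-(b : K4) ^ 2 * zeta4 - 2 * (a : K4) * b) * zeta4_sq
  rw [key]
  refine div_mem (add_mem (mul_mem ?_ hlam) ?_) (sub_mem ?_ ?_)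
  · exact_mod_cast natCast_mem L (a ^ 2 + b ^ 2)
  · exact mul_mem (mul_mem (by exact_mod_cast natCast_mem L 2) (by exact_mod_cast natCast_mem L a))
      (by exact_mod_cast natCast_mem L b)
  · exact pow_mem (by exact_mod_cast natCast_mem L a) 2
  · exact pow_mem (by exact_mod_cast natCast_mem L b) 2

/-- `ℚ(λ_{a,b}) = ℚ(ζ₄)`: the point is minimally presented. [folklore] -/
theorem gaussPoint_isMinimal (hp : (a ^ 2 + b ^ 2).Prime) (hp2 : a ^ 2 + b ^ 2 ≠ 2) : (gaussPoint a b).IsMinimal := by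
  show IntermediateField.adjoin ℚ ({lam a b} : Set K4) = ⊤
  haveI := isCyclotomicExtension_K4
  rw [eq_top_iff]
  intro x _
  have hx : x ∈ Algebra.adjoin ℚ ({zeta4} : Set K4) := by
    rw [IsCyclotomicExtension.adjoin_primitive_root_eq_top zeta4_isPrimitiveRoot]; trivial
  have hle : Algebra.adjoin ℚ ({zeta4} : Set K4) ≤ (IntermediateField.adjoin ℚ ({lam a b} : Set K4)).toSubalgebra :=
    Algebra.adjoin_le (Set.singleton_subset_iff.2 (zeta4_mem_adjoin_lam hp hp2))
  exact hle hx

/-- `P_{a,b} ∈ U(ℚ̄)^{≤2}` (minimal, of degree `[ℚ(ζ₄):ℚ] = 2`). [folklore] -/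
theorem gaussPoint_mem_UPle (hp : (a ^ 2 + b ^ 2).Prime) (hp2 : a ^ 2 + b ^ 2 ≠ 2) : gaussPoint a b ∈ UPle 2 :=
  ⟨⟨gaussPoint_inU hp, gaussPoint_isMinimal hp hp2⟩, by show Module.finrank ℚ K4 ≤ 2; rw [finrank_K4]⟩


/-! ### The `2`-adic conjugates -/

/-- In `ℚ̄₂`: `‖n‖ ≤ 1` for an integer `n`. [folklore] -/
theorem padic_norm_natCast_le_one (n : ℕ) : ‖(n : PadicAlgCl 2)‖ ≤ 1 := by
  rw [show (n : PadicAlgCl 2) = algebraMap ℚ_[2] (PadicAlgCl 2) ((n : ℤ) : ℚ_[2]) by simp, PadicAlgCl.norm_extends]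
  exact Padic.norm_int_le_one _

/-- In `ℚ̄₂`: `‖n‖ = 1` for an odd integer `n`. [folklore] -/
theorem padic_norm_natCast_of_odd {n : ℕ} (hn : Odd n) : ‖(n : PadicAlgCl 2)‖ = 1 := by
  rw [show (n : PadicAlgCl 2) = algebraMap ℚ_[2] (PadicAlgCl 2) ((n : ℤ) : ℚ_[2]) by simp, PadicAlgCl.norm_extends]
  refine le_antisymm (Padic.norm_int_le_one _) (not_lt.1 fun h => ?_)
  rw [Padic.norm_intCast_lt_one_iff] at h
  have : 2 ∣ n := by exact_mod_cast h
  exact (Nat.not_even_iff_odd.2 hn) (even_iff_two_dvd.2 this)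

/-- In `ℚ̄₂`: a square root `i` of `−1` has `‖i‖ = 1` and `‖i − 1‖² = ‖2‖ = 1/2`, so `‖i − 1‖ ≥ 1/2`. [folklore] -/
theorem padic_norm_sqrt_neg_one {i : PadicAlgCl 2} (hi : i ^ 2 = -1) : ‖i‖ = 1 ∧ 1 / 2 ≤ ‖i - 1‖ := by
  have h1 : ‖i‖ = 1 := by
    have h : ‖i‖ ^ 2 = 1 := by rw [← norm_pow, hi, norm_neg, norm_one]
    nlinarith [norm_nonneg i]
  refine ⟨h1, ?_⟩
  have h2 : ‖(2 : PadicAlgCl 2)‖ = 2⁻¹ := by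
    have h := Padic.norm_p (p := 2)
    simp only [Nat.cast_ofNat] at h
    rw [← map_ofNat (algebraMap ℚ_[2] (PadicAlgCl 2)) 2, PadicAlgCl.norm_extends, h]
  have hsq : ‖i - 1‖ ^ 2 = 2⁻¹ := by
    rw [← norm_pow, show (i - 1) ^ 2 = -2 * i by linear_combination hi, norm_mul, norm_neg, h2, h1, mul_one]
  nlinarith [norm_nonneg (i - 1)]

/-- **The `2`-adic conjugates of `λ_{a,b}` are `1/2`-far from the cusps**: for every `σ : ℚ(ζ₄) → ℚ̄₂`,
`‖σλ‖ = 1` and `‖σλ − 1‖ ≥ 1/2` (`σλ − 1 = (a+b)(σζ − 1)·α/p` with `‖α‖ = ‖ᾱ‖ = 1`, `p`, `a+b` odd). [folklore] -/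
theorem padic_farFromCusps (hp : (a ^ 2 + b ^ 2).Prime) (hp2 : a ^ 2 + b ^ 2 ≠ 2) (σ : K4 →+* PadicAlgCl 2) :
    (1 / 2 : ℝ) ≤ ‖σ (lam a b)‖ ∧ ‖σ (lam a b)‖ ≤ (1 / 2 : ℝ)⁻¹ ∧ (1 / 2 : ℝ) ≤ ‖σ (lam a b) - 1‖ := by
  set i := σ zeta4 with hi
  have hi2 : i ^ 2 = -1 := by rw [hi, ← map_pow, zeta4_sq, map_neg, map_one]
  obtain ⟨hni, hni1⟩ := padic_norm_sqrt_neg_one hi2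
  have hpodd : Odd (a ^ 2 + b ^ 2) := hp.odd_of_ne_two hp2
  have hnp : ‖((a ^ 2 + b ^ 2 : ℕ) : PadicAlgCl 2)‖ = 1 := padic_norm_natCast_of_odd hpodd
  -- `‖σα‖, ‖σᾱ‖ ≤ 1` with product `‖p‖ = 1`, hence both `= 1`
  have hα : σ (alphaK a b) = (a : PadicAlgCl 2) + (b : PadicAlgCl 2) * i := by simp [alphaK, hi]
  have hᾱ : σ (alphaBar a b) = (a : PadicAlgCl 2) - (b : PadicAlgCl 2) * i := by simp [alphaBar, hi]
  have hle1 : ‖σ (alphaK a b)‖ ≤ 1 := by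
    rw [hα]
    refine (IsUltrametricDist.norm_add_le_max _ _).trans (max_le (padic_norm_natCast_le_one a) ?_)
    rw [norm_mul, hni, mul_one]; exact padic_norm_natCast_le_one b
  have hle2 : ‖σ (alphaBar a b)‖ ≤ 1 := by
    rw [hᾱ, sub_eq_add_neg]
    refine (IsUltrametricDist.norm_add_le_max _ _).trans (max_le (padic_norm_natCast_le_one a) ?_)
    rw [norm_neg, norm_mul, hni, mul_one]; exact padic_norm_natCast_le_one b
  have hprod : ‖σ (alphaK a b)‖ * ‖σ (alphaBar a b)‖ = 1 := by
    rw [← norm_mul, ← map_mul, alphaK_mul_alphaBar, map_natCast, hnp]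
  have hnα : ‖σ (alphaK a b)‖ = 1 := by nlinarith [norm_nonneg (σ (alphaK a b)), norm_nonneg (σ (alphaBar a b))]
  -- `‖σλ‖ = 1`
  have hp0 : ((a ^ 2 + b ^ 2 : ℕ) : K4) ≠ 0 := by exact_mod_cast hp.ne_zero
  have hnlam : ‖σ (lam a b)‖ = 1 := by
    rw [lam, map_div₀, map_mul, map_pow, map_natCast, norm_div, norm_mul, norm_pow, ← hi, hni, hnα, hnp]; norm_num
  refine ⟨by rw [hnlam]; norm_num, by rw [hnlam]; norm_num, ?_⟩
  -- `σλ − 1 = σ(α)·(a+b)·(i − 1)/p`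
  have hsub : σ (lam a b) - 1 = σ (alphaK a b) * ((a + b : ℕ) : PadicAlgCl 2) * (i - 1) / ((a ^ 2 + b ^ 2 : ℕ) : PadicAlgCl 2) := by
    have hp0' : ((a ^ 2 + b ^ 2 : ℕ) : PadicAlgCl 2) ≠ 0 := by
      intro h; rw [h, norm_zero] at hnp; exact zero_ne_one hnp
    rw [eq_div_iff hp0', lam, map_div₀, map_mul, map_pow, map_natCast, ← hi, sub_mul, div_mul_cancel₀ _ hp0',
      one_mul, hα]
    push_cast
    linear_combination ((a : PadicAlgCl 2) * b + (b : PadicAlgCl 2) ^ 2 * i - (b : PadicAlgCl 2) ^ 2) * hi2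
  rw [hsub, norm_div, norm_mul, norm_mul, hnα, hnp, padic_norm_natCast_of_odd (odd_add_of_prime hp hp2)]
  simpa using hni1

/-! ### The complex conjugates -/

/-- In `ℂ`: a square root `i` of `−1` is `±I`, has `‖i‖ = 1` and `‖i − 1‖² = 2`. [folklore] -/
theorem complex_sqrt_neg_one {i : ℂ} (hi : i ^ 2 = -1) : (i = Complex.I ∨ i = -Complex.I) ∧ ‖i‖ = 1 ∧ ‖i - 1‖ ^ 2 = 2 := by
  have hI : i = Complex.I ∨ i = -Complex.I := by
    apply sq_eq_sq_iff_eq_or_eq_neg.1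
    rw [hi, Complex.I_sq]
  refine ⟨hI, ?_, ?_⟩
  · have h : ‖i‖ ^ 2 = 1 := by rw [← norm_pow, hi, norm_neg, norm_one]
    nlinarith [norm_nonneg i]
  · rw [← norm_pow, show (i - 1) ^ 2 = -2 * i by linear_combination hi, norm_mul, norm_neg]
    rcases hI with h | h <;> simp [h]

/-- **The complex conjugates of `λ_{a,b}` are `1/2`-far from the cusps**: for every `σ : ℚ(ζ₄) → ℂ`, `|σλ| = 1` and
`|σλ − 1|² = 2(a+b)²/p > 1/4`. [folklore] -/
theorem complex_farFromCusps (hp : (a ^ 2 + b ^ 2).Prime) (σ : K4 →+* ℂ) :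
    (1 / 2 : ℝ) < ‖σ (lam a b)‖ ∧ ‖σ (lam a b)‖ < (1 / 2 : ℝ)⁻¹ ∧ (1 / 2 : ℝ) < ‖σ (lam a b) - 1‖ := by
  set i := σ zeta4 with hi
  have hi2 : i ^ 2 = -1 := by rw [hi, ← map_pow, zeta4_sq, map_neg, map_one]
  obtain ⟨hI, hni, hni1⟩ := complex_sqrt_neg_one hi2
  obtain ⟨ha, hb⟩ := pos_of_prime hp
  have hpR : (0 : ℝ) < (a ^ 2 + b ^ 2 : ℕ) := by exact_mod_cast hp.pos
  have hα : σ (alphaK a b) = (a : ℂ) + (b : ℂ) * i := by simp [alphaK, hi]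
  -- `|σα|² = a² + b² = p`
  have hnα : ‖σ (alphaK a b)‖ ^ 2 = ((a ^ 2 + b ^ 2 : ℕ) : ℝ) := by
    rw [hα, Complex.sq_norm]
    rcases hI with h | h
    · rw [h]; exact_mod_cast Complex.normSq_add_mul_I a b
    · rw [h, show (a : ℂ) + (b : ℂ) * -Complex.I = ((a : ℝ) : ℂ) + ((-(b : ℝ) : ℝ) : ℂ) * Complex.I by push_cast; ring,
        Complex.normSq_add_mul_I]
      push_cast; ring
  have hnp : ‖((a ^ 2 + b ^ 2 : ℕ) : ℂ)‖ = ((a ^ 2 + b ^ 2 : ℕ) : ℝ) := by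
    rw [Complex.norm_natCast]
  -- `|σλ| = 1`
  have hnlam : ‖σ (lam a b)‖ = 1 := by
    rw [lam, map_div₀, map_mul, map_pow, map_natCast, norm_div, norm_mul, norm_pow, ← hi, hni, hnα, hnp, one_mul,
      div_self hpR.ne']
  refine ⟨by rw [hnlam]; norm_num, by rw [hnlam]; norm_num, ?_⟩
  -- `σλ − 1 = σ(α)·(a+b)·(i − 1)/p`, so `|σλ − 1|² = 2(a+b)²/p > 1/4`
  have hp0' : ((a ^ 2 + b ^ 2 : ℕ) : ℂ) ≠ 0 := by exact_mod_cast hp.ne_zero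
  have hsub : σ (lam a b) - 1 = σ (alphaK a b) * ((a + b : ℕ) : ℂ) * (i - 1) / ((a ^ 2 + b ^ 2 : ℕ) : ℂ) := by
    rw [eq_div_iff hp0', lam, map_div₀, map_mul, map_pow, map_natCast, ← hi, sub_mul, div_mul_cancel₀ _ hp0',
      one_mul, hα]
    push_cast
    linear_combination ((a : ℂ) * b + (b : ℂ) ^ 2 * i - (b : ℂ) ^ 2) * hi2
  have hsq : ‖σ (lam a b) - 1‖ ^ 2 = 2 * ((a + b : ℕ) : ℝ) ^ 2 / ((a ^ 2 + b ^ 2 : ℕ) : ℝ) := by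
    rw [hsub, norm_div, norm_mul, norm_mul, div_pow, mul_pow, mul_pow, hnα, hni1, hnp, Complex.norm_natCast]
    field_simp
  have hlt : (1 / 2 : ℝ) ^ 2 < ‖σ (lam a b) - 1‖ ^ 2 := by
    rw [hsq, lt_div_iff₀ hpR]
    push_cast
    have ha' : (1 : ℝ) ≤ a := by exact_mod_cast ha
    have hb' : (1 : ℝ) ≤ b := by exact_mod_cast hb
    nlinarith
  exact lt_of_pow_lt_pow_left₀ 2 (norm_nonneg _) hlt

/-- **`P_{a,b}` lies in the annulus compactly bounded subset with support `{∞, 2}` and radius `1/2`** (all its complex and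
`2`-adic conjugates are `1/2`-far from the cusps `0, 1, ∞`; [GenEll] Ex. 1.3 (ii), the tree's `CBData.annulus`).
[cite: MochizukiGenEll2010, Ex 1.3 (ii) p.5] -/
theorem gaussPoint_mem_annulus (hp : (a ^ 2 + b ^ 2).Prime) (hp2 : a ^ 2 + b ^ 2 ≠ 2) :
    gaussPoint a b ∈ (CBData.annulus {2} (fun p hp => by rw [Finset.mem_singleton.1 hp]; exact Nat.prime_two)
      (1 / 2) (by norm_num) le_rfl).toSet := by
  refine NFPoint.farFromCusps_mem_toSet _ _ _ ⟨fun σ => complex_farFromCusps hp σ, fun p hp' _ σ => ?_⟩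
  have hp2' : p = 2 := Finset.mem_singleton.1 hp'
  subst hp2'
  exact padic_farFromCusps hp hp2 σ

end Point

end Summit.ABC.IUTFork.Joshi.ATS4

end
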